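import Mathlib
import HarnessLib
import Literature.Geometry.Lorentzian.Stationary
import Literature.Geometry.Lorentzian.KillingFlowIsometry
import Literature.Geometry.Lorentzian.ConvergenceTransport
import Literature.Geometry.Lorentzian.ZeroEnergyRayTrappedModFlow
import Literature.Geometry.Lorentzian.Geodesic

/-!
# Crux `ErgoregionBombModT` (stmt-FinalStateConjecture-17838) — ideator 1, round 1: first lemmas

Sketch file of the crux-ideate seat `planner-cruxidea-stmt-FinalStateConjecture-17838-1-0`
(published as `Cruxes/ErgoregionBombModT/SketchIdeator1.lean`).  It backs

* the negative note `Negative-notes/zero-energy-species.md` (species of trapped zero-energy rays):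
  the negative-energy cage (`killing_sq_nonneg_of_negEnergy`), the species lemma
  (`holonomy_eq_one_of_energy_ne_zero`: a ray closed modulo the flow with non-zero Killing energy has
  trivial affine holonomy) and the completeness core of isochronous closed rays
  (`Ici_subset_of_shift_invariant`) — all proved; plus the typed shape `NegativeEnergySatellites` of the
  satellite-family statement, which the note (§3 (C4)) argues is generically FALSE in the crux's live
  class and which is kept here only as the precise statement that was examined;
* the idea card `Ideas/collar-circle-without-aik.md`: the linear-algebra rigidity step
  (`eq_id_of_fix_null_hyperplane`, proved: a linear isometry of a non-degenerate quadratic space fixing a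
  null hyperplane `K^⊥` pointwise is the identity) and the typed telescope-level statement
  `CollarAxialPeriodicity`.

`lean check`: rc 0, 0 sorries (2026-08-17).
-/

noncomputable section

open Bundle Set Filter Function
open scoped Manifold ContDiff Topology

namespace Summit.FinalStateConjecture.FinalStateConjecture.Cruxes.ErgoregionBombModT.Ideator1

open Literature.Geometry.Lorentzian

universe u

/-! ## Negative note `zero-energy-species` (species of trapped zero-energy rays) -/

section Cage

variable (𝓑 : StationaryAFBlackHole.{u})

/-- **Negative-energy cage.** At a point `x` carrying a future-directed causal vector `v` of
NEGATIVE Killing energy (`E = -g(v,T) < 0`, i.e. `0 < g(v, T x)`), the stationary field is not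
future-timelike; if `T` is future-directed wherever it is timelike (true on the d.o.c. of the
telescope), then `0 ≤ g(T,T)` at `x`: negative-energy null rays never leave the closed ergoregion,
in either time direction (the time-symmetric strengthening of the tree lemma
`killing_sq_nonneg_of_zeroEnergyNull`).  Provable now. -/
theorem killing_sq_nonneg_of_negEnergy {x : 𝓑.carrier} {v : TangentSpace (𝓡 4) x}
    (hv : 𝓑.timeOrientation.IsFutureDirected v)
    (hE : 0 < 𝓑.metric.val x v (𝓑.killing x))
    (hTfut : 𝓑.metric.IsTimelike (𝓑.killing x) → 𝓑.timeOrientation.IsFutureDirected (𝓑.killing x)) :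
    0 ≤ 𝓑.metric.val x (𝓑.killing x) (𝓑.killing x) := by
  by_contra h
  have htl : 𝓑.metric.IsTimelike (𝓑.killing x) := not_le.mp h
  have hlt : 𝓑.metric.val x (𝓑.killing x) v < 0 :=
    TimeOrientation.IsFutureDirected.val_lt_zero 𝓑.timeOrientation (hTfut htl) htl hv
  rw [𝓑.metric.symm x] at hlt
  exact absurd hE (not_lt.mpr hlt.le)

end Cage

section Species

variable (𝓑 : StationaryAFBlackHole.{u}) [𝓑.metric.HasLeviCivita]

omit [𝓑.metric.HasLeviCivita] in
/-- **Species lemma (a ray closed modulo the flow with `E ≠ 0` is isochronous).**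
Let `θ` be the stationary flow (`StationaryAFBlackHole.exists_stationary_flow`: `θₜ` isometries,
`dθₜ T = T ∘ θₜ`).  If a curve `γ` returns modulo the flow after parameter time `s₀` with affine
holonomy `μ` — `γ t₂ = θ_τ (γ t₁)` and `γ̇(t₂) = μ · dθ_τ(γ̇(t₁))` — and its Killing energy
`g(γ̇,T)` takes the same NON-ZERO value at `t₁` and `t₂` (conservation lemma along geodesics,
`killingEnergy_eq_of_isGeodesicOn`), then `μ = 1`.  Consequence (card): anisochronous (`μ ≠ 1`)
closed rays are exactly zero-energy ones; a closed ray which is a limit of closed non-zero-energy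
rays is isochronous.  Provable now (three rewrites). -/
theorem holonomy_eq_one_of_energy_ne_zero
    (θ : ℝ × 𝓑.carrier → 𝓑.carrier)
    (hiso : ∀ (t : ℝ) (p : 𝓑.carrier) (v w : TangentSpace (𝓡 4) p),
      𝓑.metric.val (θ (t, p)) (mfderiv (𝓡 4) (𝓡 4) (fun q ↦ θ (t, q)) p v)
        (mfderiv (𝓡 4) (𝓡 4) (fun q ↦ θ (t, q)) p w) = 𝓑.metric.val p v w)
    (hgen : ∀ (t : ℝ) (p : 𝓑.carrier),
      mfderiv (𝓡 4) (𝓡 4) (fun q ↦ θ (t, q)) p (𝓑.killing p) = 𝓑.killing (θ (t, p)))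
    (γ : ℝ → 𝓑.carrier) (t₁ t₂ τ μ : ℝ)
    (hret : γ t₂ = θ (τ, γ t₁))
    (hvel : velocity (𝓡 4) γ t₂ =
      μ • (mfderiv (𝓡 4) (𝓡 4) (fun q ↦ θ (τ, q)) (γ t₁) (velocity (𝓡 4) γ t₁) :
        TangentSpace (𝓡 4) (θ (τ, γ t₁))))
    (hE : 𝓑.metric.val (γ t₂) (velocity (𝓡 4) γ t₂) (𝓑.killing (γ t₂)) =
      𝓑.metric.val (γ t₁) (velocity (𝓡 4) γ t₁) (𝓑.killing (γ t₁)))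
    (hE0 : 𝓑.metric.val (γ t₁) (velocity (𝓡 4) γ t₁) (𝓑.killing (γ t₁)) ≠ 0) :
    μ = 1 := by
  rw [hret] at hE
  rw [hvel, ← hgen τ (γ t₁)] at hE
  simp only [map_smul, FunLike.coe_smul, Pi.smul_apply, smul_eq_mul] at hE
  rw [hiso] at hE
  exact (mul_eq_right₀ hE0).mp hE

/-- **Isochronous closed rays are complete.**  Real-analysis core: an order-connected set of
parameters containing `a` and invariant under the shift `t ↦ t + s₀`, `s₀ > 0`, contains
`[a, ∞)`; with the backward shift as well it is all of `ℝ`.  For an isochronous ray closed modulo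
the flow (`γ (t + s₀) = θ_τ (γ t)`, `μ = 1`) maximality of the geodesic makes its domain `s`
shift-invariant both ways, hence `s = univ`: such rays are the two-sided-complete witnesses of the
crux's antecedent, and (card `zero-energy-surface-gravity` of crux 10691, contrapositive) the
anisochronous ones are exactly the incomplete witnesses that the rev-6 MAXIMAL-geodesic typing
newly admits.  Provable now. -/
theorem Ici_subset_of_shift_invariant {s : Set ℝ} (hs : s.OrdConnected) {a s₀ : ℝ} (ha : a ∈ s)
    (hs₀ : 0 < s₀) (hshift : ∀ t ∈ s, t + s₀ ∈ s) : Set.Ici a ⊆ s := by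
  intro t ht
  obtain ⟨n, hn⟩ := Archimedean.arch (t - a) hs₀
  have hmem : ∀ k : ℕ, a + k * s₀ ∈ s := by
    intro k
    induction k with
    | zero => simpa using ha
    | succ k ih =>
      have h := hshift _ ih
      convert h using 1
      push_cast
      ring
  refine hs.out ha (hmem n) ⟨ht, ?_⟩
  have hn' : t - a ≤ n * s₀ := by simpa [nsmul_eq_mul] using hn
  linarith

/-- Typed shape of the SATELLITE-FAMILY STATEMENT examined by this seat (NOT claimed — the negative
note `zero-energy-species.md` §3 (C4) argues it is generically false for non-axisymmetric holes: the
periodic-orbit cylinder through an isochronous closed zero-energy ray is its own scaling family and stays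
at `E = 0`): near a closed zero-energy null ray `γ₀` (closed modulo the flow `θ`, isochronous) which is
non-degenerate in a sense abstracted as `NonDeg γ₀`, for every sufficiently small `E` of either sign there
would be a null geodesic `γ_E`, closed modulo the flow, of Killing energy `g(γ̇_E, T) = -E`.  Recorded so
that the examined claim has a checkable signature over tree declarations. -/
def NegativeEnergySatellites (NonDeg : (ℝ → 𝓑.carrier) → Prop) : Prop :=
  ∀ (θ : ℝ × 𝓑.carrier → 𝓑.carrier), (∀ p, θ (0, p) = p) →
    (∀ t s p, θ (t, θ (s, p)) = θ (t + s, p)) → (∀ p, IsMIntegralCurve (fun t ↦ θ (t, p)) 𝓑.killing) →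
    ∀ (γ₀ : ℝ → 𝓑.carrier) (s₀ τ₀ : ℝ), 0 < s₀ →
      IsGeodesicOn 𝓑.metric.toPseudoRiemannianMetric.leviCivita γ₀ Set.univ →
      (∀ t, 𝓑.metric.val (γ₀ t) (velocity (𝓡 4) γ₀ t) (velocity (𝓡 4) γ₀ t) = 0 ∧
        velocity (𝓡 4) γ₀ t ≠ 0 ∧ 𝓑.metric.val (γ₀ t) (velocity (𝓡 4) γ₀ t) (𝓑.killing (γ₀ t)) = 0) →
      (∀ t, γ₀ (t + s₀) = θ (τ₀, γ₀ t)) → NonDeg γ₀ →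
      ∃ ε > 0, ∀ E ∈ Set.Ioo (-ε) ε, ∃ (γ : ℝ → 𝓑.carrier) (s₁ τ₁ : ℝ), 0 < s₁ ∧
        IsGeodesicOn 𝓑.metric.toPseudoRiemannianMetric.leviCivita γ Set.univ ∧
        (∀ t, 𝓑.metric.val (γ t) (velocity (𝓡 4) γ t) (velocity (𝓡 4) γ t) = 0 ∧
          velocity (𝓡 4) γ t ≠ 0 ∧ 𝓑.metric.val (γ t) (velocity (𝓡 4) γ t) (𝓑.killing (γ t)) = -E) ∧
        ∀ t, γ (t + s₁) = θ (τ₁, γ t)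

end Species

/-! ## Card `collar-circle-without-aik` -/

section Collar

/-- **Linear-algebra rigidity step.**  On a finite-dimensional real vector space with a
non-degenerate symmetric bilinear form `B`, a `B`-isometry `A` which fixes pointwise the
`B`-orthogonal hyperplane `K^⊥` of a non-zero NULL vector `K` is the identity.  (Proof: for `n`
with `B K n ≠ 0`, `A n - n ⊥ K^⊥`, so `A n - n ∈ (K^⊥)^⊥ = ℝ K`; then `B (A n) (A n) = B n n` forces
the coefficient to vanish.)  This is the step "an isometry of the collar which is the identity on
the Killing horizon `𝓗⁺` (a null hypersurface with `T𝓗⁺ = K^⊥`) has identity differential there,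
hence is the identity" in the card's derivation of the periodic axial field.  Mathlib-only;
provable now (size S). -/
theorem eq_id_of_fix_null_hyperplane {V : Type*} [AddCommGroup V] [Module ℝ V]
    (B : LinearMap.BilinForm ℝ V) (hB : ∀ m : V, (∀ n : V, B m n = 0) → m = 0)
    (hBs : ∀ x y : V, B x y = B y x)
    (K : V) (hK : K ≠ 0) (hKnull : B K K = 0) (A : V →ₗ[ℝ] V)
    (hA : ∀ v w, B (A v) (A w) = B v w) (hfix : ∀ v, B K v = 0 → A v = v) :
    A = LinearMap.id := by
  -- a vector `n` transverse to the null hyperplane `K^⊥`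
  obtain ⟨n, hn⟩ : ∃ n, B K n ≠ 0 := by
    by_contra h
    push Not at h
    exact hK (hB K h)
  have hAK : A K = K := hfix K hKnull
  -- `w := A n - n` is `B`-orthogonal to `K^⊥`
  have hperp : ∀ u, B K u = 0 → B (A n - n) u = 0 := by
    intro u hu
    have h1 := hA n u
    rw [hfix u hu] at h1
    rw [map_sub, LinearMap.sub_apply, h1, sub_self]
  have hKw : B K (A n - n) = 0 := by
    have h1 := hA K n
    rw [hAK] at h1
    rw [map_sub, h1, sub_self]
  set w := A n - n with hw_def
  have hww : B w w = 0 := hperp w hKw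
  have h3 : A n = w + n := by rw [hw_def]; abel
  -- isometry on `n` forces `B w n = 0`
  have hwn : B w n = 0 := by
    have h1 := hA n n
    rw [h3, LinearMap.map_add₂, map_add, map_add, hww, hBs n w] at h1
    linarith
  -- hence `B w v = 0` for every `v`, so `w = 0`
  have hsplit : ∀ v, B K (v - (B K v / B K n) • n) = 0 := by
    intro v
    rw [map_sub, map_smul, smul_eq_mul, div_mul_cancel₀ _ hn, sub_self]
  have hw0 : w = 0 := by
    refine hB _ fun v ↦ ?_
    have h1 := hperp _ (hsplit v)
    rw [map_sub, map_smul, smul_eq_mul, hwn, mul_zero, sub_zero] at h1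
    exact h1
  have hAn : A n = n := by rw [h3, hw0, zero_add]
  -- and finally `A = id`
  ext v
  have hv : v = (v - (B K v / B K n) • n) + (B K v / B K n) • n := by abel
  rw [LinearMap.id_apply, hv, map_add, map_smul, hAn, hfix _ (hsplit v)]

variable (𝓑 : StationaryAFBlackHole.{u}) [𝓑.metric.HasLeviCivita]

/-- **Collar axial periodicity (typed telescope-level statement of the card).**  In the prefix of
the crux's telescope (collar `(U, K)`: `K` smooth Killing on the open `U ⊇ 𝓗⁺`, `[T, K] = 0` on
`U`, `K ≠ 0` and tangent on the connected horizon, `K` timelike on `U ∩ doc`), the difference field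
`R := K - T` has a common period on an invariant sub-collar: there are `P > 0` and an open
`U' ⊇ 𝓗⁺` inside `U` such that every integral curve of `R` starting in `U'` stays in `U'` and is
`P`-periodic.  (`R ≡ 0` on `𝓗⁺` is the non-rotating branch; otherwise `Φ_H := (P/2π) R` is the
collar axial Killing field and `Ω_H := 2π/P` the intrinsic angular velocity of the hole.)  The
card derives it from compactness of the isometry group of the horizon cross-section and
`eq_id_of_fix_null_hyperplane`; no analyticity, no bifurcation sphere, no field equations. -/
def CollarAxialPeriodicity : Prop :=
  ∀ (U : Set 𝓑.carrier) (K : Π x : 𝓑.carrier, TangentSpace (𝓡 4) x), IsOpen U → 𝓑.horizon ⊆ U →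
    IsConnected 𝓑.horizon →
    ContMDiffOn (𝓡 4) ((𝓡 4).prod 𝓘(ℝ, E4)) ((⊤ : ℕ∞) : WithTop ℕ∞)
      (fun x ↦ (Bundle.TotalSpace.mk' E4 x (K x) : TangentBundle (𝓡 4) 𝓑.carrier)) U →
    (∀ x ∈ U, ∀ v w : TangentSpace (𝓡 4) x, 𝓑.metric.val x (𝓑.metric.leviCivita K x v) w +
      𝓑.metric.val x v (𝓑.metric.leviCivita K x w) = 0) →
    (∀ x ∈ U, VectorField.mlieBracket (𝓡 4) 𝓑.killing K x = 0) → (∀ p ∈ 𝓑.horizon, K p ≠ 0) →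
    (∀ γ : ℝ → 𝓑.carrier, IsMIntegralCurve γ K → γ 0 ∈ 𝓑.horizon → ∀ t, γ t ∈ 𝓑.horizon) →
    (∀ x ∈ U ∩ 𝓑.doc, 𝓑.metric.val x (K x) (K x) < 0) →
    (∃ p ∈ 𝓑.horizon, K p ≠ 𝓑.killing p) →
    ∃ P : ℝ, 0 < P ∧ ∃ U' : Set 𝓑.carrier, IsOpen U' ∧ 𝓑.horizon ⊆ U' ∧ U' ⊆ U ∧
      ∀ γ : ℝ → 𝓑.carrier, IsMIntegralCurve γ (fun x ↦ K x - 𝓑.killing x) → γ 0 ∈ U' →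
        (∀ t, γ t ∈ U') ∧ ∀ t, γ (t + P) = γ t

end Collar

end Summit.FinalStateConjecture.FinalStateConjecture.Cruxes.ErgoregionBombModT.Ideator1
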